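import Literature.NumberTheory.Automorphic.LanglandsTunnellReduction
import Literature.NumberTheory.Automorphic.LanglandsTunnellModThree
import Literature.NumberTheory.GaloisRepresentations.ArtinCharacterReciprocityProofs
import Literature.NumberTheory.Automorphic.TunnellOctahedralGlobalProofs
import Literature.NumberTheory.Automorphic.PiOfArtinRepFrobSatakeCompatibleProofs
import Literature.NumberTheory.GaloisRepresentations.GL2F3Lift
import HarnessLib

/-!
# Stub-ideation k = 2, GENERATION 11 (home family 2 — RESHAPE) for `stub_modThree`

Companion of `STUB-IDEAS-stub_modThree-2.md` (gen 11).  Nothing registered; the stub statement is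
copied verbatim as `SigStubModThree`.

* `stubModThree_of_open_leaves` (R1, carried from gens 8–10, PROVED): the typed stub from the eight
  currently OPEN leaves of the tree's Langlands–Tunnell decomposition (re-probed 2026-08-31T23:15Z:
  still 0 unconditional `_holds` among the eight) — the plan of record.
* T5 contract (no Lean needed here): whatever proves weight-one modularity of odd irreducible
  `σ : Γ_ℚ → GL₂(ℂ)` — in particular any future 2-adic ("dyadic") weight-one lifting road for
  `σ = Ψ ∘ ρ̄` — enters the tree through the fact `khareWintenberger_weightOne_of_isOdd` and the
  proved glue `langlands_tunnell_of_weightOne_of_isOdd` (`OddArtinWeightOne.lean`), then the tree's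
  closer `WeierstrassCurve.isModular_of_isTorsionGaloisRep_three_of_langlands_tunnell`; no new
  interface is needed for such a road (module not imported: unbuilt on the farm snapshot today).
* **B5 certificates** (T5/T6, `decide` on the `GL2F3Lift.M2` encoding of
  `S = Ψ(GL₂(𝔽₃)) ⊂ GL₂(ℤ[√-2])`), about the OTHER prime `𝔮 = (√-2)` of `ℤ[√-2]` above `2`:
  `B5a` the kernel of reduction mod `𝔮` is the quaternion group `elemsQ = Q₈`;
  `B5b` its image has `6` elements (all of `GL₂(𝔽₂) ≅ S₃`);
  `B5c` every element of determinant `-1` (e.g. `σ(Frob₂)`, as `χ₃(Frob₂) = -1`) reduces mod `𝔮`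
  to a non-trivial element of square `1` — a transvection of `GL₂(𝔽₂)`: `σ̄₂(Frob₂)` never has
  distinct eigenvalues, so `σ` is never residually `2`-distinguished;
  `B5d` yet in characteristic `0` every element of determinant `-1` has distinct eigenvalues
  (`tr² - 4 det ≠ 0`): the eigenvalues of `σ(Frob₂)` are distinct and congruent mod `𝔮`;
  `B5e` two non-commuting elements of `S` never share an eigenvector (`det (xy - yx) ≠ 0`), so
  `σ|_{D₂}` fixes a line (is nearly ordinary at `𝔮`) iff `ρ̄(D₂)` is abelian.
-/

open scoped MatrixGroups NumberField
open Literature.NumberTheory.EllipticCurves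
open Literature.NumberTheory.Automorphic
open Literature.NumberTheory.GaloisRepresentations
open WeierstrassCurve

set_option linter.dupNamespace false

namespace Summit.ABC.ABC.Cruxes.FreyModularity.StubModThreeIdeasK2G11

/-! ## B5 — certificates at the prime `𝔮 = (√-2)` (kernel computations, computable section) -/

namespace Cert

open Literature.NumberTheory.GaloisRepresentations.GL2F3Lift

/-- Reduction of `a + b√-2 ∈ ℤ[√-2]` modulo `𝔮 = (√-2)`: `√-2 ↦ 0`, i.e. `a mod 2`
(`ℤ[√-2]/𝔮 = 𝔽₂`; agrees with the ring homomorphism `redTwoHom`, `redTwoHom_apply`). -/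
def redTwo (z : ℤ√(-2)) : ZMod 2 := ((z.re : ℤ) : ZMod 2)

/-- Entrywise reduction mod `𝔮`, as a `4`-tuple over `𝔽₂`. -/
def redTwoM (x : M2) : ZMod 2 × ZMod 2 × ZMod 2 × ZMod 2 :=
  (redTwo x.a, redTwo x.b, redTwo x.c, redTwo x.d)

/-- Entrywise difference of two arrays. -/
def subM (x y : M2) : M2 := ⟨x.a - y.a, x.b - y.b, x.c - y.c, x.d - y.d⟩

/-- Trace `a + d`. -/
def trM (x : M2) : ℤ√(-2) := x.a + x.d

/-- `0² = -2` in `𝔽₂`. -/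
theorem zero_mul_zero_zmod_two : (0 : ZMod 2) * 0 = ((-2 : ℤ) : ZMod 2) := by decide

/-- **Reduction modulo `𝔮 = (√-2)`** as a ring homomorphism `ℤ[√-2] → 𝔽₂` (Mathlib `Zsqrtd.lift`). -/
def redTwoHom : ℤ√(-2) →+* ZMod 2 :=
  Zsqrtd.lift ⟨0, zero_mul_zero_zmod_two⟩

/-- `redTwoHom (a + b√-2) = a (mod 2)`. -/
theorem redTwoHom_apply (z : ℤ√(-2)) : redTwoHom z = redTwo z := by
  simp [redTwoHom, Zsqrtd.lift_apply_apply, redTwo]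

/-- **B5a.** The kernel of reduction mod `𝔮` on `S` is exactly `elemsQ ≅ Q₈`. Kernel-checked. -/
theorem B5a_ker_redTwo : ∀ x ∈ M2.elems, (redTwoM x = (1, 0, 0, 1) ↔ x ∈ M2.elemsQ) := by decide

/-- **B5b.** The image of `S` mod `𝔮` has `6` elements (all of `GL₂(𝔽₂) ≅ S₃`; `48 / 8 = 6`).
Kernel-checked. -/
theorem B5b_card_image_redTwo : ((M2.elems.map redTwoM).dedup).length = 6 := by decide

/-- **B5c.** Every element of `S` of determinant `-1` reduces mod `𝔮` to a NON-trivial element whose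
square is trivial (a transposition of `S₃` = a transvection of `GL₂(𝔽₂)`, eigenvalues `1, 1`).
Applied to `σ(Frob₂) = Ψ(ρ̄(Frob₂))` (`det = χ₃(Frob₂) = -1` since `2 ≡ -1 mod 3`): `σ̄₂(Frob₂)` is a
transvection, so `σ̄₂|_{D₂}` is never a sum of two DISTINCT characters. Kernel-checked. -/
theorem B5c_det_neg_one_residual_transvection :
    ∀ x ∈ M2.elems, M2.det x = -1 → redTwoM x ≠ (1, 0, 0, 1) ∧ redTwoM (M2.mul x x) = (1, 0, 0, 1) := by
  decide

/-- **B5d.** In characteristic `0` every element of `S` of determinant `-1` has DISTINCT eigenvalues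
(discriminant `tr² - 4 det = tr² + 4 ≠ 0` in `ℤ[√-2]`; they are `{1, -1}` or `{ζ₈^a, ζ₈^{-a}·(-1)…}`):
together with `B5c`, the two eigenvalues of `σ(Frob₂)` are distinct but congruent mod `𝔮`.
Kernel-checked. -/
theorem B5d_det_neg_one_distinct_eigenvalues :
    ∀ x ∈ M2.elems, M2.det x = -1 → trM x * trM x - 4 * M2.det x ≠ 0 := by decide

/-- **B5e.** Two non-commuting elements of `S` have no common eigenvector: `det (xy - yx) ≠ 0`
(for `2 × 2` matrices over a field, a common eigenvector `v` gives `(xy - yx) v = 0`).  Hence a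
subgroup `H ≤ GL₂(𝔽₃)` has `Ψ(H)` inside a Borel of `GL₂(ℂ)` iff `H` is abelian: `σ = Ψ ∘ ρ̄` is
nearly ordinary at `𝔮` iff `ρ̄(D₂)` is abelian. Kernel-checked (`48 × 48` pairs). -/
theorem B5e_noncommuting_no_common_eigenvector :
    ∀ x ∈ M2.elems, ∀ y ∈ M2.elems,
      M2.mul x y ≠ M2.mul y x → M2.det (subM (M2.mul x y) (M2.mul y x)) ≠ 0 := by
  decide

end Cert

/-! ## The stub and R1 (carried) -/

noncomputable section

/-- The registered stub statement, verbatim. -/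
def SigStubModThree : Prop :=
  ∀ (W : WeierstrassCurve ℚ) [W.IsElliptic] (ρ : ModPGaloisRep ℚ (ZMod 3) 2),
    W.IsTorsionGaloisRep 3 ρ → FramedRep.IsAbsolutelyIrreducible ρ → ρ.IsModular

/-- **R1 (carried, PROVED).** The typed stub from the eight OPEN leaves of
`langlands_tunnell_of_leaves`; the three discharged leaves are fed by their `_holds` theorems.
This is the stub's exact trust base and the plan of record. -/
theorem stubModThree_of_open_leaves
    (hAI : automorphicInduction_character)
    (hdesc3 : exists_cuspidal_descent_det_cubic) (hGJ : GelbartJacquet_adjoint_lift)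
    (hJS : JacquetShalika_eq_of_rsData_eq) (hdesc : cuspidal_descent_cyclic)
    (ha : ArthurClozel_fibres_quadratic) (hb : tunnell_cuspidal_cubic_lifts)
    (hW1 : exists_isNewform1_of_isPiOfArtinRep) : SigStubModThree :=
  fun W _ ρ hρ habs ↦
    W.isModular_of_isTorsionGaloisRep_three_of_langlands_tunnell
      (langlands_tunnell_of_leaves artinReciprocity_character_holds hAI hdesc3 hGJ hJS hdesc
        exists_twist_quadraticSign_holds ha hb frobSatakeCompatibleAt_of_isPiOfArtinRep_holds hW1)
      ρ hρ habs

/-- **T6 criterion (statement only, prover-sized S; Mathlib linear algebra).** A finite subgroup of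
`GL₂(ℂ)` fixing a line is abelian (its unipotent part is torsion, hence trivial in characteristic
`0`).  With `B5e` this gives: `Ψ(H)` lies in a Borel iff `H ≤ GL₂(𝔽₃)` is abelian. -/
def FiniteLineStabiliserAbelian : Prop :=
  ∀ (H : Subgroup (GL (Fin 2) ℂ)), Finite H →
    (∃ v : Fin 2 → ℂ, v ≠ 0 ∧ ∀ h ∈ H, ∃ a : ℂ, (h : Matrix (Fin 2) (Fin 2) ℂ).mulVec v = a • v) →
    ∀ x ∈ H, ∀ y ∈ H, x * y = y * x

end

end Summit.ABC.ABC.Cruxes.FreyModularity.StubModThreeIdeasK2G11
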